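import Summits.CriticalPhenomena.CardyFormulaZ2.Theorems.CardyTensorRGPolyominoGaussianLawSquareLimitPart1
import Summits.CriticalPhenomena.CardyFormulaZ2.Theorems.CardyWhiteToColouredSimilarityUpgradeStubRectangleDuality
import Summits.CriticalPhenomena.CardyFormulaZ2.Theorems.CardyTensorRGPolyominoGaussianLawStubDilationEquicontinuity

/-!
# The bond-`ℤ²` crossing probability of the unit square tends to `1/2` — Part 2:
# `P_{1/2}(LR crossing of the n × n box) → 1/2`
# (crux `PolyominoGaussianLaw`, stmt-CriticalPhenomena-14337, route `CardyTensorRG`, line `registered`)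

**Theorem (`sq_tendsto_crossingProb_self`).** For critical bond percolation on `ℤ²`, the probability
`crossingProb half n n` of an open left–right crossing of the lattice box `[0, n]²` tends to `1/2`.

The lower bound `1/2 ≤ crossingProb half n n` is in the tree (`half_le_crossingProb_self`, from the
exact self-duality `crossingProb half (n+1) n = 1/2`). The upper bound is the content of this file:
for `ε > 0` and `n` large, `crossingProb half n n ≤ 1/2 + ε`. Proof. Read the box at mesh
`δ = 1/(n+2)` inside the unit square `Ω = (0,1)²` with its left/right sides `L`, `R`:
`crossingProb half n n = bondDomainCrossingProb R_LR δ` exactly, for the conformal rectangle `R_LR`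
with carrier `Ω` and arcs `L`, `R` (`RectangleDuality.bond_lr_eq`, tree; `sq_exists_unitSquareLR`).
H21's discrete crossing event of `(Ω; L, R)` is contained in the Schramm–Smirnov crossing event of the
slightly NARROWER quad `Q_β = [(1-β)/2, (1+β)/2] × [0,1]` (`dl_discreteCrossing_subset_cross`, tree,
frame `Ψ_LR` = "halve, shift, swap"), and the Schramm–Smirnov crossing event of the half-integer box
quad `Q_δ = [δ/2, 1-δ/2] × [3δ/2, 1-δ/2]` is contained in the lattice left–right crossing of the box
`(0,1) + [0, n+2] × [0, n+1]` (Part 1, `sq_cross_subset_openCrossing`), of probability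
`crossingProb half (n+2) (n+1) = 1/2`. Both quads are within `r` of the unit-square quad `Q₀` for
`β` close to `1` and `δ` small, so Schramm–Smirnov's uniform continuity (5.1) for bond-`ℤ²`
(`Quad.continuity_uniform_pair` + `Quad.continuity_of_lemma_5_1` + `SchrammSmirnov2011_lemma_5_1_holds`,
all tree) gives `P(Q_β crossed ∧ Q_δ not crossed) ≤ ε`, whence
`crossingProb half n n ≤ P(Q_β crossed) ≤ P(Q_δ crossed) + ε ≤ 1/2 + ε`.
-/

noncomputable section

open Set Metric Complex MeasureTheory Filter Topology
open scoped unitInterval ENNReal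
open Literature.Probability.LatticeModels Literature.Probability.Percolation
open Literature.Probability.Percolation.QuadCrossing
open Literature.Probability.RandomPlanarGeometry (ConformalRectangle)

namespace Summit.CriticalPhenomena.CardyFormulaZ2.Cruxes.PolyominoGaussianLaw.Birth

/-! ### The unit square as a conformal rectangle, crossed left-to-right or bottom-to-top -/

/-- The swap maps a product box to the swapped product box. [folklore] -/
theorem sq_image_swap_reProdIm {S : ℂ ≃ₜ ℂ} (hS : ∀ z, S z = ⟨z.im, z.re⟩) (s t : Set ℝ) :
    S '' (s ×ℂ t) = t ×ℂ s := by
  ext w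
  simp only [mem_image, mem_reProdIm]
  constructor
  · rintro ⟨z, ⟨h1, h2⟩, rfl⟩
    rw [hS]; exact ⟨h2, h1⟩
  · rintro ⟨h1, h2⟩
    exact ⟨⟨w.im, w.re⟩, ⟨h2, h1⟩, by rw [hS]⟩

/-- **The unit square crossed LEFT-TO-RIGHT is a polyomino conformal rectangle with lattice marks**:
there is a conformal rectangle with carrier `(0,1)²`, arc `0` the left side, arc `2` the right side and
the four corners as marks (the tree's `rectQuad 0 1 0 1` with coordinates swapped). [folklore] -/
theorem sq_exists_unitSquareLR : ∃ R : ConformalRectangle,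
    R.carrier = Ioo (0 : ℝ) 1 ×ℂ Ioo (0 : ℝ) 1 ∧
    R.arc 0 = {z : ℂ | z.re = 0 ∧ z.im ∈ Icc (0 : ℝ) 1} ∧
    R.arc 2 = {z : ℂ | z.re = 1 ∧ z.im ∈ Icc (0 : ℝ) 1} ∧
    ∀ i, ∃ m n : ℤ, R.pt i = ((1 : ℝ) : ℂ) * ((m : ℂ) + (n : ℂ) * Complex.I) := by
  obtain ⟨S, hS⟩ := sq_exists_swap
  set R₀ : ConformalRectangle := rectQuad 0 1 0 1 zero_lt_one zero_lt_one with hR₀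
  have harc0 : R₀.arc 0 = {z : ℂ | z.im = 0 ∧ z.re ∈ Icc (0 : ℝ) 1} :=
    Set.ext fun z => mem_rectQuad_arc_zero zero_lt_one zero_lt_one
  have harc1 : R₀.arc 1 = {z : ℂ | z.re = 1 ∧ z.im ∈ Icc (0 : ℝ) 1} :=
    Set.ext fun z => mem_rectQuad_arc_one zero_lt_one zero_lt_one
  have harc2 : R₀.arc 2 = {z : ℂ | z.im = 1 ∧ z.re ∈ Icc (0 : ℝ) 1} :=
    Set.ext fun z => mem_rectQuad_arc_two zero_lt_one zero_lt_one
  have harc3 : R₀.arc 3 = {z : ℂ | z.re = 0 ∧ z.im ∈ Icc (0 : ℝ) 1} :=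
    Set.ext fun z => mem_rectQuad_arc_three zero_lt_one zero_lt_one
  -- the corners
  have hpt : ∀ i, ∃ m n : ℤ, (R₀.pt i).re = m ∧ (R₀.pt i).im = n := by
    intro i
    fin_cases i
    · have h1 := R₀.pt_mem_arc_self 0
      have h2 := R₀.pt_succ_mem_arc 3
      rw [show (3 : Fin 4) + 1 = 0 from rfl, harc3] at h2
      rw [harc0] at h1
      exact ⟨0, 0, by exact_mod_cast h2.1, by exact_mod_cast h1.1⟩
    · have h1 := R₀.pt_mem_arc_self 1
      have h2 := R₀.pt_succ_mem_arc 0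
      rw [show (0 : Fin 4) + 1 = 1 from rfl, harc0] at h2
      rw [harc1] at h1
      exact ⟨1, 0, by exact_mod_cast h1.1, by exact_mod_cast h2.1⟩
    · have h1 := R₀.pt_mem_arc_self 2
      have h2 := R₀.pt_succ_mem_arc 1
      rw [show (1 : Fin 4) + 1 = 2 from rfl, harc1] at h2
      rw [harc2] at h1
      exact ⟨1, 1, by exact_mod_cast h2.1, by exact_mod_cast h1.1⟩
    · have h1 := R₀.pt_mem_arc_self 3
      have h2 := R₀.pt_succ_mem_arc 2
      rw [show (2 : Fin 4) + 1 = 3 from rfl, harc2] at h2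
      rw [harc3] at h1
      exact ⟨0, 1, by exact_mod_cast h1.1, by exact_mod_cast h2.1⟩
  refine ⟨R₀.map S, ?_, ?_, ?_, ?_⟩
  · rw [Literature.Probability.RandomPlanarGeometry.MarkedDomain.carrier_map, hR₀, rectQuad_carrier,
      sq_image_swap_reProdIm hS]
  · rw [Literature.Probability.RandomPlanarGeometry.MarkedDomain.arc_map, harc0]
    ext w
    simp only [mem_image, mem_setOf_eq]
    constructor
    · rintro ⟨z, ⟨h1, h2⟩, rfl⟩; rw [hS]; exact ⟨h1, h2⟩
    · rintro ⟨h1, h2⟩; exact ⟨⟨w.im, w.re⟩, ⟨h1, h2⟩, by rw [hS]⟩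
  · rw [Literature.Probability.RandomPlanarGeometry.MarkedDomain.arc_map, harc2]
    ext w
    simp only [mem_image, mem_setOf_eq]
    constructor
    · rintro ⟨z, ⟨h1, h2⟩, rfl⟩; rw [hS]; exact ⟨h1, h2⟩
    · rintro ⟨h1, h2⟩; exact ⟨⟨w.im, w.re⟩, ⟨h1, h2⟩, by rw [hS]⟩
  · intro i
    obtain ⟨m, n, hm, hn⟩ := hpt i
    refine ⟨n, m, ?_⟩
    rw [Literature.Probability.RandomPlanarGeometry.MarkedDomain.pt_map, hS]
    apply Complex.ext <;> simp [hm, hn]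

/-- **The unit square crossed BOTTOM-TO-TOP is a polyomino conformal rectangle with lattice marks**
(the tree's `rectQuad 0 1 0 1`). [folklore] -/
theorem sq_exists_unitSquareBT : ∃ R : ConformalRectangle,
    R.carrier = Ioo (0 : ℝ) 1 ×ℂ Ioo (0 : ℝ) 1 ∧
    R.arc 0 = {z : ℂ | z.im = 0 ∧ z.re ∈ Icc (0 : ℝ) 1} ∧
    R.arc 2 = {z : ℂ | z.im = 1 ∧ z.re ∈ Icc (0 : ℝ) 1} ∧
    ∀ i, ∃ m n : ℤ, R.pt i = ((1 : ℝ) : ℂ) * ((m : ℂ) + (n : ℂ) * Complex.I) := by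
  set R₀ : ConformalRectangle := rectQuad 0 1 0 1 zero_lt_one zero_lt_one with hR₀
  have harc0 : R₀.arc 0 = {z : ℂ | z.im = 0 ∧ z.re ∈ Icc (0 : ℝ) 1} :=
    Set.ext fun z => mem_rectQuad_arc_zero zero_lt_one zero_lt_one
  have harc1 : R₀.arc 1 = {z : ℂ | z.re = 1 ∧ z.im ∈ Icc (0 : ℝ) 1} :=
    Set.ext fun z => mem_rectQuad_arc_one zero_lt_one zero_lt_one
  have harc2 : R₀.arc 2 = {z : ℂ | z.im = 1 ∧ z.re ∈ Icc (0 : ℝ) 1} :=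
    Set.ext fun z => mem_rectQuad_arc_two zero_lt_one zero_lt_one
  have harc3 : R₀.arc 3 = {z : ℂ | z.re = 0 ∧ z.im ∈ Icc (0 : ℝ) 1} :=
    Set.ext fun z => mem_rectQuad_arc_three zero_lt_one zero_lt_one
  have hpt : ∀ i, ∃ m n : ℤ, (R₀.pt i).re = m ∧ (R₀.pt i).im = n := by
    intro i
    fin_cases i
    · have h1 := R₀.pt_mem_arc_self 0
      have h2 := R₀.pt_succ_mem_arc 3
      rw [show (3 : Fin 4) + 1 = 0 from rfl, harc3] at h2
      rw [harc0] at h1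
      exact ⟨0, 0, by exact_mod_cast h2.1, by exact_mod_cast h1.1⟩
    · have h1 := R₀.pt_mem_arc_self 1
      have h2 := R₀.pt_succ_mem_arc 0
      rw [show (0 : Fin 4) + 1 = 1 from rfl, harc0] at h2
      rw [harc1] at h1
      exact ⟨1, 0, by exact_mod_cast h1.1, by exact_mod_cast h2.1⟩
    · have h1 := R₀.pt_mem_arc_self 2
      have h2 := R₀.pt_succ_mem_arc 1
      rw [show (1 : Fin 4) + 1 = 2 from rfl, harc1] at h2
      rw [harc2] at h1
      exact ⟨1, 1, by exact_mod_cast h2.1, by exact_mod_cast h1.1⟩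
    · have h1 := R₀.pt_mem_arc_self 3
      have h2 := R₀.pt_succ_mem_arc 2
      rw [show (2 : Fin 4) + 1 = 3 from rfl, harc2] at h2
      rw [harc3] at h1
      exact ⟨0, 1, by exact_mod_cast h1.1, by exact_mod_cast h2.1⟩
  refine ⟨R₀, by rw [hR₀, rectQuad_carrier], harc0, harc2, fun i => ?_⟩
  obtain ⟨m, n, hm, hn⟩ := hpt i
  refine ⟨m, n, ?_⟩
  apply Complex.ext <;> simp [hm, hn]

/-! ### Distances of square-model quads -/

/-- Two square models whose frames are uniformly `C`-close on the closed model square have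
`C`-close quads. [folklore] -/
theorem sq_dist_squareModelQuad_le {F G : ℂ ≃ₜ ℂ} {C : ℝ} (hC : 0 ≤ C)
    (h : ∀ z ∈ Icc (-1 : ℝ) 1 ×ℂ Icc (-1 : ℝ) 1, dist (F z) (G z) ≤ C) :
    dist (squareModelQuad F) (squareModelQuad G) ≤ C := by
  rw [Quad.dist_eq, ContinuousMap.dist_le hC]
  intro z
  simp only [Quad.toContinuousMap_apply, squareModelQuad_apply]
  apply h
  rw [← range_unitSquareChart]
  exact mem_range_self z

/-! ### The left-to-right frame of the unit square and the half-integer box quads -/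

/-- **The frame `Ψ_LR`** ("halve, shift by `(1+i)/2`, swap"): it maps the open model square onto
`(0,1)²`, the bottom/top model sides onto the LEFT/RIGHT sides, halves distances, and its vertical
squeezes `sc` (`(re, im) ↦ (re, β im)`) give quads within `(1-β)/2` of its quad. [folklore] -/
theorem sq_exists_frameLR : ∃ Ψ : ℂ ≃ₜ ℂ,
    (∀ z, Ψ z = ⟨1 / 2 * z.im + 1 / 2, 1 / 2 * z.re + 1 / 2⟩) ∧
    (∀ z w, dist (Ψ z) (Ψ w) = 1 / 2 * dist z w) ∧
    Ψ '' (Ioo (-1 : ℝ) 1 ×ℂ Ioo (-1 : ℝ) 1) = Ioo (0 : ℝ) 1 ×ℂ Ioo (0 : ℝ) 1 ∧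
    Ψ '' {p : ℂ | p.im = -1 ∧ p.re ∈ Icc (-1 : ℝ) 1} = {z : ℂ | z.re = 0 ∧ z.im ∈ Icc (0 : ℝ) 1} ∧
    Ψ '' {p : ℂ | p.im = 1 ∧ p.re ∈ Icc (-1 : ℝ) 1} = {z : ℂ | z.re = 1 ∧ z.im ∈ Icc (0 : ℝ) 1} ∧
    ∀ (sc : ℂ ≃ₜ ℂ) (β : ℝ), (∀ z, sc z = ⟨1 * z.re, β * z.im⟩) → 0 < β → β < 1 →
      dist (squareModelQuad (sc.trans Ψ)) (squareModelQuad Ψ) ≤ (1 - β) / 2 := by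
  obtain ⟨S, hS⟩ := sq_exists_swap
  obtain ⟨A₀, hA₀⟩ := sq_exists_affine (1 / 2) (1 / 2) (1 / 2) (1 / 2) (by norm_num) (by norm_num)
  have hΨapply : ∀ z, (A₀.trans S) z = ⟨1 / 2 * z.im + 1 / 2, 1 / 2 * z.re + 1 / 2⟩ := fun z =>
    sq_frame_apply hA₀ hS z
  have hnorm : ∀ u : ℂ, ‖(⟨1 / 2 * u.im, 1 / 2 * u.re⟩ : ℂ)‖ = 1 / 2 * ‖u‖ := by
    intro u
    have h1 : ‖(⟨1 / 2 * u.im, 1 / 2 * u.re⟩ : ℂ)‖ ^ 2 = (1 / 2 * ‖u‖) ^ 2 := by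
      rw [mul_pow, Complex.sq_norm, Complex.sq_norm, Complex.normSq_apply, Complex.normSq_apply]
      ring
    exact (pow_left_inj₀ (norm_nonneg _) (by positivity) two_ne_zero).1 h1
  have hΨdist : ∀ z w, dist ((A₀.trans S) z) ((A₀.trans S) w) = 1 / 2 * dist z w := by
    intro z w
    rw [dist_eq_norm, dist_eq_norm, hΨapply, hΨapply, ← hnorm (z - w)]
    congr 1
    apply Complex.ext <;> simp <;> ring
  refine ⟨A₀.trans S, hΨapply, hΨdist, ?_, ?_, ?_, ?_⟩
  · rw [sq_image_frame_Ioo hA₀ hS (by norm_num) (by norm_num)]; norm_num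
  · rw [sq_image_frame_bottom hA₀ hS (by norm_num)]; norm_num
  · rw [sq_image_frame_top hA₀ hS (by norm_num)]; norm_num
  · intro sc β hsc hβ0 hβ1
    refine sq_dist_squareModelQuad_le (by linarith) fun z hz => ?_
    rw [Homeomorph.trans_apply, hΨdist]
    have h := dl_dist_scale_le hsc hz
    rw [sub_self, abs_zero, zero_add, abs_of_neg (by linarith)] at h
    linarith

/-- **The half-integer box quads at mesh `δ = 1/(n+2)`**: a quad whose Schramm–Smirnov crossing
event is contained in the lattice left–right crossing of the self-dual box `(0,1) + [0,n+2] × [0,n+1]`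
and which is within `2δ` of the quad of every frame agreeing with `Ψ_LR`. [folklore] -/
theorem sq_exists_boxQuad {n : ℕ} (hn : 1 ≤ n) {δ : ℝ} (hδ : 0 < δ) (hnδ : δ * ((n : ℝ) + 2) = 1) :
    ∃ Q : Quad (univ : Set ℂ),
      {ω | ∃ K, Q.IsCrossing K ∧ K ⊆ openEdgeUnion δ ω} ⊆
        openCrossing ((· + (![0, 1] : Site 2)) '' (↑(rectangle (n + 2) (n + 1)) : Set (Site 2)))
          ((· + (![0, 1] : Site 2)) '' (↑(leftSide (n + 2) (n + 1)) : Set (Site 2)))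
          ((· + (![0, 1] : Site 2)) '' (↑(rightSide (n + 2) (n + 1)) : Set (Site 2))) ∧
      ∀ Ψ : ℂ ≃ₜ ℂ, (∀ z, Ψ z = ⟨1 / 2 * z.im + 1 / 2, 1 / 2 * z.re + 1 / 2⟩) →
        dist Q (squareModelQuad Ψ) ≤ 2 * δ := by
  have hnpos : (0 : ℝ) < n := by exact_mod_cast hn
  obtain ⟨S, hS⟩ := sq_exists_swap
  obtain ⟨A, hA⟩ := sq_exists_affine ((n : ℝ) * δ / 2) (1 / 2 + δ / 2) (((n : ℝ) + 1) * δ / 2) (1 / 2)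
    (by positivity) (by positivity)
  obtain ⟨hTcar, hT0, hT2⟩ := sq_squareModelQuad_frame hA hS (by positivity) (by positivity)
  have hnδ' : (n : ℝ) * δ = 1 - 2 * δ := by linarith
  refine ⟨squareModelQuad (A.trans S), ?_, ?_⟩
  · refine sq_cross_subset_openCrossing hδ (n := 0) (m := 1) (a := n + 2) (b := n + 1) _ ?_ ?_ ?_
    · rw [hTcar]
      rintro z ⟨⟨h1, h2⟩, h3, h4⟩
      refine ⟨⟨?_, ?_⟩, ?_, ?_⟩
      · push_cast; linarith only [h1, hnδ']
      · push_cast; linarith only [h2, hnδ']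
      · push_cast; linarith only [h3, hnδ']
      · push_cast; linarith only [h4, hnδ']
    · rw [hT0]
      rintro z ⟨h1, -⟩
      rw [mem_setOf_eq, h1]; push_cast; linarith only [hnδ']
    · rw [hT2]
      rintro z ⟨h1, -⟩
      rw [mem_setOf_eq, h1]; push_cast; linarith only [hnδ']
  · intro Ψ hΨ
    refine sq_dist_squareModelQuad_le (by positivity) fun z hz => ?_
    obtain ⟨⟨h1, h2⟩, h3, h4⟩ := hz
    rw [sq_frame_apply hA hS, hΨ, dist_eq_norm]
    refine (norm_le_abs_re_add_abs_im _).trans ?_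
    rw [Complex.sub_re, Complex.sub_im]
    have e1 : ((⟨((n : ℝ) + 1) * δ / 2 * z.im + 1 / 2, (n : ℝ) * δ / 2 * z.re + (1 / 2 + δ / 2)⟩ : ℂ)).re -
        ((⟨1 / 2 * z.im + 1 / 2, 1 / 2 * z.re + 1 / 2⟩ : ℂ)).re = -(δ / 2) * z.im := by
      show ((n : ℝ) + 1) * δ / 2 * z.im + 1 / 2 - (1 / 2 * z.im + 1 / 2) = -(δ / 2) * z.im
      have : ((n : ℝ) + 1) * δ = 1 - δ := by linarith only [hnδ']
      rw [this]; ring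
    have e2 : ((⟨((n : ℝ) + 1) * δ / 2 * z.im + 1 / 2, (n : ℝ) * δ / 2 * z.re + (1 / 2 + δ / 2)⟩ : ℂ)).im -
        ((⟨1 / 2 * z.im + 1 / 2, 1 / 2 * z.re + 1 / 2⟩ : ℂ)).im = -δ * z.re + δ / 2 := by
      show (n : ℝ) * δ / 2 * z.re + (1 / 2 + δ / 2) - (1 / 2 * z.re + 1 / 2) = -δ * z.re + δ / 2
      rw [hnδ']; ring
    rw [e1, e2]
    have a1 : |-(δ / 2) * z.im| ≤ δ / 2 := by
      rw [abs_mul, abs_neg, abs_of_pos (by positivity : (0 : ℝ) < δ / 2)]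
      have : |z.im| ≤ 1 := abs_le.2 ⟨h3, h4⟩
      nlinarith only [this, hδ]
    have a2 : |-δ * z.re + δ / 2| ≤ 3 * δ / 2 := by
      refine (abs_add_le _ _).trans ?_
      rw [abs_mul, abs_neg, abs_of_pos hδ, abs_of_pos (by positivity : (0 : ℝ) < δ / 2)]
      have : |z.re| ≤ 1 := abs_le.2 ⟨h1, h2⟩
      nlinarith only [this, hδ]
    linarith only [a1, a2]

/-! ### The upper bound `crossingProb half n n ≤ 1/2 + ε` -/

/-- **Eventually `crossingProb half n n ≤ 1/2 + ε`.** See the module docstring. [folklore] -/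
theorem sq_crossingProb_self_le_eventually {ε : ℝ} (hε : 0 < ε) :
    ∃ N : ℕ, ∀ n : ℕ, N ≤ n → crossingProb half n n ≤ 1 / 2 + ε := by
  classical
  -- the left-to-right unit square and its frame
  obtain ⟨R, hRc, hR0, hR2, -⟩ := sq_exists_unitSquareLR
  obtain ⟨Ψ, hΨapply, hΨdist, hΨIoo, hΨbot, hΨtop, hΨsc⟩ := sq_exists_frameLR
  -- Schramm–Smirnov's continuity of crossing events, uniformly near the quad of the square
  set μ : Measure (BondConfig (Site 2)) := bondPercolation (zdGraph 2) half with hμ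
  have hcont : ∀ (Q₀ : Quad (univ : Set ℂ)) (e : ℝ≥0∞), 0 < e →
      ∃ Q' Q'' : Quad (univ : Set ℂ), Quad.StrictlyDominated Q' Q₀ ∧ Quad.StrictlyDominated Q₀ Q'' ∧
        ∃ δ₀ : ℝ, 0 < δ₀ ∧ ∀ δ : ℝ, 0 < δ → δ < δ₀ →
          μ {ω | (∃ K, Q'.IsCrossing K ∧ K ⊆ openEdgeUnion δ ω) ∧
            ¬ ∃ K, Q''.IsCrossing K ∧ K ⊆ openEdgeUnion δ ω} ≤ e :=
    fun Q₀ e he => Quad.continuity_of_lemma_5_1 SchrammSmirnov2011_lemma_5_1_holds Q₀ e he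
  obtain ⟨δc, hδc, r, hr, H⟩ := Quad.continuity_uniform_pair hcont
    (isCompact_singleton (x := squareModelQuad Ψ)) (ENNReal.ofReal ε) (ENNReal.ofReal_pos.2 hε)
  have key : ∀ P' P'' : Quad (univ : Set ℂ), dist P' (squareModelQuad Ψ) < r →
      dist P'' (squareModelQuad Ψ) < r → ∀ δ : ℝ, 0 < δ → δ < δc →
      μ.real ({ω | ∃ K, P'.IsCrossing K ∧ K ⊆ openEdgeUnion δ ω} \
        {ω | ∃ K, P''.IsCrossing K ∧ K ⊆ openEdgeUnion δ ω}) ≤ ε := fun P' P'' h1 h2 δ hδ hδc' => by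
    have h := H (squareModelQuad Ψ) rfl P' P'' h1 h2 δ hδ hδc'
    rw [measureReal_def]
    have h' := ENNReal.toReal_mono ENNReal.ofReal_ne_top h
    rwa [ENNReal.toReal_ofReal hε.le] at h'
  -- the narrower quad `Q_β`
  set β : ℝ := 1 - min (1 / 2) r with hβ
  have hmin : 0 < min (1 / 2 : ℝ) r := lt_min (by norm_num) hr
  have hminl := min_le_left (1 / 2 : ℝ) r
  have hminr := min_le_right (1 / 2 : ℝ) r
  have hβ0 : 0 < β := by rw [hβ]; linarith only [hminl]
  have hβ1 : β < 1 := by rw [hβ]; linarith only [hmin]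
  obtain ⟨sc, hsc⟩ := dl_exists_scaleHomeomorph (α := 1) (β := β) one_pos hβ0
  have hdistβ : dist (squareModelQuad (sc.trans Ψ)) (squareModelQuad Ψ) < r := by
    have h1 := hΨsc sc β hsc hβ0 hβ1
    have h2 : (1 - β) / 2 < r := by rw [hβ]; linarith only [hminr, hr]
    exact h1.trans_lt h2
  -- the threshold
  set M : ℝ := min (min δc (r / 2)) ((1 - β) / 4) with hM
  have hM0 : 0 < M := lt_min (lt_min hδc (by positivity)) (by linarith only [hβ1])
  obtain ⟨N, hN⟩ := exists_nat_gt (1 / M)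
  refine ⟨N + 1, fun n hn => ?_⟩
  -- the mesh `δ = 1/(n+2)`
  have hn1 : 1 ≤ n := by omega
  have hn2 : (0 : ℝ) < (n : ℝ) + 2 := by positivity
  set δ : ℝ := 1 / ((n : ℝ) + 2) with hδdef
  have hδ : 0 < δ := by positivity
  have hnδ : δ * ((n : ℝ) + 2) = 1 := by rw [hδdef]; field_simp
  have hδM : δ < M := by
    have hN' : (N : ℝ) + 1 ≤ n := by exact_mod_cast hn
    have h1 : 1 / M < (n : ℝ) + 2 := by linarith only [hN, hN']
    rw [div_lt_iff₀ hM0] at h1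
    rw [hδdef, div_lt_iff₀ hn2]
    linarith only [h1]
  have hδc' : δ < δc := hδM.trans_le ((min_le_left _ _).trans (min_le_left _ _))
  have hδr : 2 * δ < r := by
    have := hδM.trans_le ((min_le_left _ _).trans (min_le_right _ _)); linarith only [this]
  have hδβ : 4 * δ ≤ 1 - β := by
    have := hδM.trans_le (min_le_right _ _); linarith only [this]
  -- (1) exact identification with the lattice box at mesh `δ`
  have hbond : crossingProb half n n = bondDomainCrossingProb R δ :=
    (Summit.CriticalPhenomena.CardyFormulaZ2.Cruxes.SimilarityUpgrade.Stubs.RectangleDuality.bond_lr_eq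
      R hRc hR0 hR2 hδ (a := n) (b := n) (by linarith only [hnδ, hδ]) (by linarith only [hnδ]) hnδ hn1).symm
  -- (2) H21's event inside the Schramm–Smirnov event of `Q_β`
  have hη : ∀ z ∈ Ψ '' (Icc (-1 : ℝ) 1 ×ℂ Icc (-1 : ℝ) 1), ∀ z' ∈ Ψ '' (Icc (-1 : ℝ) 1 ×ℂ Icc (-1 : ℝ) 1),
      dist z z' < 2 * δ → dist (Ψ.symm z) (Ψ.symm z') < 1 - β := by
    intro z _ z' _ hzz'
    have e : dist z z' = 1 / 2 * dist (Ψ.symm z) (Ψ.symm z') := by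
      conv_lhs => rw [← Ψ.apply_symm_apply z, ← Ψ.apply_symm_apply z']
      exact hΨdist _ _
    linarith only [e, hzz', hδβ]
  have hup := dl_discreteCrossing_subset_cross Ψ sc hβ0 hsc hδ hη
  rw [hΨIoo, hΨbot, hΨtop] at hup
  have hP : bondDomainCrossingProb R δ = μ.real (discreteCrossing (Ioo (0 : ℝ) 1 ×ℂ Ioo (0 : ℝ) 1) δ
      {z : ℂ | z.re = 0 ∧ z.im ∈ Icc (0 : ℝ) 1} {z : ℂ | z.re = 1 ∧ z.im ∈ Icc (0 : ℝ) 1}) := by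
    rw [bondDomainCrossingProb_eq_measureReal, hRc, hR0, hR2]
  -- (3) the half-integer box quad and its lattice shadow, a self-dual box
  obtain ⟨QT, hshadow, hQTdist⟩ := sq_exists_boxQuad hn1 hδ hnδ
  have hdistT : dist QT (squareModelQuad Ψ) < r := (hQTdist Ψ hΨapply).trans_lt hδr
  have hhalf : μ.real (openCrossing ((· + (![0, 1] : Site 2)) '' (↑(rectangle (n + 2) (n + 1)) : Set (Site 2)))
      ((· + (![0, 1] : Site 2)) '' (↑(leftSide (n + 2) (n + 1)) : Set (Site 2)))
      ((· + (![0, 1] : Site 2)) '' (↑(rightSide (n + 2) (n + 1)) : Set (Site 2)))) = 1 / 2 := by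
    rw [hμ, sq_real_openCrossing_shift_eq]
    exact crossingProb_half_succ_self_holds (n + 1)
  -- (4) assemble
  have hfinal := dl_real_sub_le μ (subset_refl {ω | ∃ K, (squareModelQuad (sc.trans Ψ)).IsCrossing K ∧
      K ⊆ openEdgeUnion δ ω}) hshadow (key _ _ hdistβ hdistT δ hδ hδc')
  have hmono : bondDomainCrossingProb R δ ≤
      μ.real {ω | ∃ K, (squareModelQuad (sc.trans Ψ)).IsCrossing K ∧ K ⊆ openEdgeUnion δ ω} := by
    rw [hP]
    exact measureReal_mono hup (measure_ne_top _ _)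
  linarith only [hbond, hmono, hfinal, hhalf]

/-- **`P_{1/2}(LR crossing of the n × n box) → 1/2`** for critical bond percolation on `ℤ²`
(lower bound: self-duality, `half_le_crossingProb_self`; upper bound:
`sq_crossingProb_self_le_eventually`). [folklore] -/
theorem sq_tendsto_crossingProb_self :
    Filter.Tendsto (fun n : ℕ => Literature.Probability.Percolation.crossingProb
      Literature.Probability.Percolation.half n n) Filter.atTop (nhds (1 / 2)) := by
  rw [Metric.tendsto_atTop]
  intro ε hε
  obtain ⟨N, hN⟩ := sq_crossingProb_self_le_eventually (half_pos hε)
  refine ⟨N, fun n hn => ?_⟩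
  have h1 := half_le_crossingProb_self crossingProb_half_succ_self_holds n
  have h2 := hN n hn
  rw [Real.dist_eq, abs_lt]
  constructor <;> linarith

end Summit.CriticalPhenomena.CardyFormulaZ2.Cruxes.PolyominoGaussianLaw.Birth
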